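import Summits.BirchSwinnertonDyer.BirchSwinnertonDyer.Theorems.SignedLowerHalvesSmallImageLowerHalfBothSignsRttD2SeqJ3RSeq
import Summits.BirchSwinnertonDyer.BirchSwinnertonDyer.Theorems.SignedLowerHalvesSmallImageLowerHalfBothSignsRttD2SeqJ3CofreeLambda
import Summits.BirchSwinnertonDyer.BirchSwinnertonDyer.Theorems.SignedLowerHalvesSmallImageLowerHalfBothSignsRttD2SeqLocalDualO
import HarnessLib

/-!
# Route `SignedLowerHalves`, crux L `SmallImageLowerHalfBothSigns` (stmt-BirchSwinnertonDyer-23599), line `rtt_w3` v15 — E2, row J3 residual: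
# ★★★ `RSeq` FOR THE LEAD's `M = Cofree θ F` AND g22's `λ`-PAIRINGS `cofreeLamCoeffPairing`, and J3 (`exists_junction_exact_cofree_lam_seq`, p792377) WITH
# `RSeq` DISCHARGED — i.e. J3 for the LEAD's module MODULO THE SINGLE REMAINING INPUT `hsolL` (levelwise Poitou–Tate solvability)

WIDTH seat `bsd-line-slh-p3-w3` g23 under LEAD `cruxlead-stmt-BirchSwinnertonDyer-23599` g11 (cell `bsd-ssimc`); helper `--supports stmt-BirchSwinnertonDyer-23599`.
ONE DEFINITION WITH BODY (`cofreeLamCoeffPairingK`, the GLOBAL `Γ_K`-pairing whose restriction to `Γ_{K_v}` is — definitionally — g22's `cofreeLamCoeffPairing`, p792279) +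
THEOREMS; no named fact, no instance, no `sorry`. HONEST FRAMING: the reciprocity input of J3 is now PROVED (R6, p795300) for the LEAD's data; the solvability input `hsolL`
is NOT — E2, crux L, crux M, BSD remain OPEN and are proved for NO curve. Side hypotheses beyond g22's binders: `K` totally complex (`[IsTotallyComplex K]`), `v` the ONLY place
above `p`, `P ∖ S₀ ⊆ {v}`, `S₀` finite, inertia off `P` acts trivially on `M` (`θ` unramified off `P`), and the `Γ_{K_v}`-action IS `localAction` (binder `hinst`).

* `cofreeLamCoeffPairingK S lam hlam θ′ P θ hstabK hθ k : ContPairing (coeffRepK S θ′ P k) (torsRep (Cofree θ F) hstabK p k) (mu K (p^k))` (`⟪a ⊗ ζ, t/p^k⟫ = λ(a t)·ζ`, `Γ_K`-equivariant by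
  `θ′θ = 1`), `cofreeLamCoeffPairingK_hPred`.
* ★★★ **`RSeq_cofree_lam`** — the `RSeq` binder of `exists_junction_exact_cofree_lam_seq` (p792377) VERBATIM (any `hres`, `hstab`), under `hinst : ‹action› = localAction …`.
* ★★★ **`exists_junction_exact_cofree_lam_of_hsolL`** — J3 for `M = Cofree θ F`: `∃ j₀ : B′ →ₗ[Λ_𝒪] DQ.X, (toDual ∘ j₀ = strictPairing …) ∧ Function.Exact j₀ gX`, from `hsolL` ALONE
  (+ the side hypotheses above).
References: [NeukirchSchmidtWingberg2008] VIII §6, (7.2.6); [MilneADT2006] I Thm. 4.10 (b); [Rubin2000] Thm. 1.7.3, §4.2; [Kobayashi2003] Thm. 7.3 i); [Kato2004Asterisque] §17.13.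
-/

set_option autoImplicit false
set_option linter.dupNamespace false -- D-0017: single-problem summit, the namespace repeats the problem name by design
noncomputable section

open scoped Classical
open NumberField IsDedekindDomain Field Matrix CategoryTheory Function

namespace Summit.BirchSwinnertonDyer.BirchSwinnertonDyer.Theorems.SmallImageRttD2Seq

open Literature.NumberTheory.EllipticCurves Literature.NumberTheory.EllipticCurves.GreenbergSelmer Literature.NumberTheory.GaloisRepresentations
  Literature.NumberTheory.GaloisRepresentations.DiscreteGaloisModule Literature.NumberTheory.GaloisCohomology
  Literature.NumberTheory.ComplexMultiplication.EllipticUnits.JohnsonLeungKings2011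
  Summit.BirchSwinnertonDyer.BirchSwinnertonDyer.Theorems.SmallImageCharSignedSelmer Summit.BirchSwinnertonDyer.BirchSwinnertonDyer.Theorems.SmallImageRttD2J1

/-! ## §1. The global `λ`-pairing -/

section Global

variable {K : Type} [Field K] [NumberField K] {p : ℕ} [Fact p.Prime] (S : Set (PadicAlgCl p)) (lam : padicCoeffIntegers S →+ ℤ_[p])
  (hlam : ∀ (c : ℤ_[p]) (y : padicCoeffIntegers S), lam (padicIntToCoeffIntegers S c * y) = c * lam y)
  (θ' : absoluteGaloisGroup K →ₜ* (padicCoeffIntegers S)ˣ) (P : Set (HeightOneSpectrum (𝓞 K))) (θ : FramedGaloisRep K (padicCoeffIntegers S) 1)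
  (hstabK : ∀ m : Cofree θ (padicCoeffField S), IsOpen (MulAction.stabilizer (absoluteGaloisGroup K) m : Set (absoluteGaloisGroup K)))
  (hθ : ∀ σ : absoluteGaloisGroup K,
    ((θ' σ : (padicCoeffIntegers S)ˣ) : padicCoeffIntegers S) * ((θ σ : GL (Fin 1) (padicCoeffIntegers S)) : Matrix (Fin 1) (Fin 1) (padicCoeffIntegers S)) 0 0 = 1)

include hlam

/-- **The GLOBAL coefficient pairing `X_k × M[p^k] → μ_{p^k}` over `Γ_K`** for `M = Cofree θ F`: the same bilinear map `cofreeLamCoeffLin` (`⟪a ⊗ ζ, t/p^k⟫ = λ(a t)·ζ`) as g22's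
`Γ_{K_v}`-pairing `cofreeLamCoeffPairing` (p792279), equivariant under ALL of `Γ_K` because `θ′θ = 1`. Its restriction along `res_v` (R2's `resPairingAt`) is `cofreeLamCoeffPairing`
DEFINITIONALLY (same `toLin`). [cite: Rubin2000, §4.2] [cite: NeukirchSchmidtWingberg2008, (7.2.6)] -/
def cofreeLamCoeffPairingK (k : ℕ) :
    ContPairing (coeffRepK S θ' P k).toTopRep (torsRep (Cofree θ (padicCoeffField S)) hstabK p k).toTopRep (mu K (p ^ k)).toTopRep :=
  ContPairing.ofDiscrete (X := (coeffRepK S θ' P k).toTopRep) (Y := (torsRep (Cofree θ (padicCoeffField S)) hstabK p k).toTopRep)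
    (Z := (mu K (p ^ k)).toTopRep) (cofreeLamCoeffLin S lam hlam θ' P θ k) fun g x m ↦ by
    rw [cofreeLamCoeffLin_apply, cofreeLamCoeffLin_apply]
    exact cofreeLamPairing_muTwistO_smul S K lam hlam θ k θ' g (hθ g) (x : OMuCarrier K S (p ^ k)) m

/-- Unfolding `cofreeLamCoeffPairingK`. [folklore] -/
theorem cofreeLamCoeffPairingK_toLin (k : ℕ) (x : ↥(Representation.invariants ((muTwistO S θ' k).toRepresentation.comp (ramificationSubgroup K P).subtype)))
    (m : ↥(torsionPow (Cofree θ (padicCoeffField S)) p k)) :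
    (cofreeLamCoeffPairingK S lam hlam θ' P θ hstabK hθ k).toLin x m = cofreeLamPairing S K lam hlam θ k (x : OMuCarrier K S (p ^ k)) m :=
  rfl

/-- `hPred` for the global `λ`-pairings (compatibility with reduction on `X` and inclusion on `M[p^k]`, through `μ_{p^k} ⊆ μ_{p^{k+1}}`). [cite: NeukirchSchmidtWingberg2008, (7.1.4), (7.2.6)] -/
theorem cofreeLamCoeffPairingK_hPred (k : ℕ) (x : ↥(Representation.invariants ((muTwistO S θ' (k + 1)).toRepresentation.comp (ramificationSubgroup K P).subtype)))
    (m : ↥(torsionPow (Cofree θ (padicCoeffField S)) p k)) :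
    (cofreeLamCoeffPairingK S lam hlam θ' P θ hstabK hθ (k + 1)).toLin x
        (AddSubgroup.inclusion (torsionPow_mono (M := Cofree θ (padicCoeffField S)) (p := p) (Nat.le_succ k)) m) =
      muInclusion K (pow_dvd_pow p (Nat.le_succ k))
        ((cofreeLamCoeffPairingK S lam hlam θ' P θ hstabK hθ k).toLin (coeffMapO S P θ' (oMuRed S k) (oMuRed_muTwistO S θ' k) x) m) := by
  rw [cofreeLamCoeffPairingK_toLin, cofreeLamCoeffPairingK_toLin]
  exact (muInclusion_cofreeLamPairing_oMuRed S K lam hlam θ k (x : OMuCarrier K S (p ^ (k + 1))) m).symm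

end Global

/-! ## §2. `RSeq` for the LEAD's module and J3 modulo `hsolL` -/

section Cofree

variable {K : Type} [Field K] [NumberField K] {p : ℕ} [Fact p.Prime] {κ : ZpExtension K p} {γ : absoluteGaloisGroup K}
  (S : Set (PadicAlgCl p)) [FiniteDimensional ℚ_[p] (padicCoeffField S)] (lam : padicCoeffIntegers S →+ ℤ_[p])
  (hlam : ∀ (c : ℤ_[p]) (y : padicCoeffIntegers S), lam (padicIntToCoeffIntegers S c * y) = c * lam y)
  (θ : FramedGaloisRep K (padicCoeffIntegers S) 1)
  {V : WeierstrassCurve K} {j : V.geomPrimaryTorsion p →+ Cofree θ (padicCoeffField S)} {S₀ : Set (HeightOneSpectrum (𝓞 K))} {ε : ℤˣ}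
  (D : SignedTransportDualDataSat κ γ (Cofree θ (padicCoeffField S)) (padicCoeffIntegers S) V j S₀ ε)
  {v : HeightOneSpectrum (𝓞 K)} [inst : DistribMulAction (absoluteGaloisGroup (v.adicCompletion K)) (Cofree θ (padicCoeffField S))]
  [SMulCommClass (absoluteGaloisGroup (v.adicCompletion K)) (padicCoeffIntegers S) (Cofree θ (padicCoeffField S))]
  {γv : absoluteGaloisGroup (v.adicCompletion K)} (DQ : LocalCondDualData κ (Cofree θ (padicCoeffField S)) (padicCoeffIntegers S) V j ε v γv)
  (hres : ∀ (σ : absoluteGaloisGroup (v.adicCompletion K)) (m : Cofree θ (padicCoeffField S)), σ • m = resGalOfEmb (closureEmb (K := K) (v.adicCompletion K)) σ • m)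
  (hvp : (p : 𝓞 K) ∈ v.asIdeal)
  {γB : absoluteGaloisGroup K} {θ' : absoluteGaloisGroup K →ₜ* (padicCoeffIntegers S)ˣ} {P : Set (HeightOneSpectrum (𝓞 K))}
  (I : CycIwasawaCohomologyDataO S κ γB θ' P 1)
  (hstab : ∀ m : Cofree θ (padicCoeffField S),
    IsOpen (MulAction.stabilizer (absoluteGaloisGroup (v.adicCompletion K)) m : Set (absoluteGaloisGroup (v.adicCompletion K))))
  (hθ : ∀ σ : absoluteGaloisGroup K,
    ((θ' σ : (padicCoeffIntegers S)ˣ) : padicCoeffIntegers S) * ((θ σ : GL (Fin 1) (padicCoeffIntegers S)) : Matrix (Fin 1) (Fin 1) (padicCoeffIntegers S)) 0 0 = 1)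
  (htor : ∀ m : Cofree θ (padicCoeffField S), ∃ k : ℕ, p ^ k • m = 0)
  (hγB : γB * resGalOfEmb (closureEmb (K := K) (v.adicCompletion K)) γv ∈ κ.kerSubgroup)
  (hNP : ∀ n, ramificationSubgroup K P ≤ κ.layerSubgroup n) (hv : AcSigned.IsNonsplitIn κ v)

omit [FiniteDimensional ℚ_[p] (padicCoeffField S)] in
include htor hv in
/-- ★★★ **`RSeq` FOR `M = Cofree θ F` AND THE `λ`-PAIRINGS** — the hypothesis `RSeq` of `exists_junction_exact_cofree_lam_seq` (p792377) VERBATIM, proved when `K` is totally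
complex, `v` is the only place above `p` and is non-split in `K_∞`, `P ∖ S₀ ⊆ {v}` (`P`, `S₀` finite), inertia off `P` acts trivially on `M`, and the `Γ_{K_v}`-action is the
restriction along `res_v` (`hinst`). From R6 (`locPairNK_eq_zero_of_globalPairing`) with `PG := cofreeLamCoeffPairingK` (whose restriction IS `cofreeLamCoeffPairing`).
[cite: NeukirchSchmidtWingberg2008, VIII §6] [cite: MilneADT2006, Ch. I, Thm. 4.10(b)] [cite: Rubin2000, Thm. 1.7.3, §4.2] [cite: Kato2004Asterisque, §17.13] -/
theorem RSeq_cofree_lam [IsTotallyComplex K] (hinst : inst = localAction (closureEmb (K := K) (v.adicCompletion K)) (Cofree θ (padicCoeffField S)))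
    (hstabK : ∀ m : Cofree θ (padicCoeffField S), IsOpen (MulAction.stabilizer (absoluteGaloisGroup K) m : Set (absoluteGaloisGroup K)))
    (hP : P.Finite) (hS₀ : S₀.Finite) (hPS₀ : ∀ w ∈ P, w ∉ S₀ → w = v) (hpv : ∀ w : HeightOneSpectrum (𝓞 K), ((p : ℕ) : 𝓞 K) ∈ w.asIdeal → w = v)
    (hMP : ∀ w : HeightOneSpectrum (𝓞 K), w ∉ P → ∀ 𝔓 ∈ w.primesAbove, ∀ τ ∈ 𝔓.inertia (absoluteGaloisGroup K), ∀ m : Cofree θ (padicCoeffField S), τ • m = m)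
    (n : ℕ) (y : ∀ k : ℕ, cycLayerCohO S κ θ' P n k 1) (hyS : ∀ k, y k ∈ strictLevel S κ θ' P S₀ n k)
    (hyR : ∀ k, cycLayerRedO S κ θ' P n k 1 (y (k + 1)) = y k) (k : ℕ)
    (ℓ : subgroupH1 (localSubgroupOfEmb (κ.layerSubgroup n) (closureEmb (K := K) (v.adicCompletion K))) ↥(torsionPow (Cofree θ (padicCoeffField S)) p k))
    (c : subgroupH1 (κ.layerSubgroup n) (Cofree θ (padicCoeffField S)))
    (hc : c ∈ signedTransportSelmerLayerSat κ (Cofree θ (padicCoeffField S)) (padicCoeffIntegers S) V j S₀ ε n)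
    (hℓ : torsToH1 (Cofree θ (padicCoeffField S)) p _ k ℓ = locH1Layer κ (Cofree θ (padicCoeffField S)) v hres n c) :
    locPairNK S κ θ' P v (Cofree θ (padicCoeffField S)) hstab (cofreeLamCoeffPairing S lam hlam θ' P v θ hres hstab hθ) n k (y k) ℓ = 0 := by
  subst hinst
  exact locPairNK_eq_zero_of_globalPairing S κ θ' P v (Cofree θ (padicCoeffField S)) hstabK V j S₀ ε (cofreeLamCoeffPairingK S lam hlam θ' P θ hstabK hθ)
    (cofreeLamCoeffPairingK_hPred S lam hlam θ' P θ hstabK hθ) htor hP hS₀ hPS₀ hpv hMP hv hstab n y hyS hyR k ℓ c hc hℓ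

/-- ★★★ **J3 FOR THE LEAD's `M = Cofree θ F` MODULO `hsolL` ONLY**: `exists_junction_exact_cofree_lam_seq` (g22, p792377) with its reciprocity input `RSeq` DISCHARGED by
`RSeq_cofree_lam` — there is `j₀ : B′ →ₗ[Λ_𝒪] DQ.X` on the strict carrier `B′` with `toDual ∘ j₀ = strictPairing …` and `Function.Exact j₀ gX`, given the levelwise solvability
`hsolL` and the side hypotheses of `RSeq_cofree_lam`. [cite: Kobayashi2003, Thm. 7.3 i)] [cite: Rubin2000, Thm. 1.7.3, §4.2] [cite: NeukirchSchmidtWingberg2008, VIII §6, (7.2.6)]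
[cite: Kato2004Asterisque, §17.13] -/
theorem exists_junction_exact_cofree_lam_of_hsolL [IsTotallyComplex K]
    (hinst : inst = localAction (closureEmb (K := K) (v.adicCompletion K)) (Cofree θ (padicCoeffField S)))
    (instX : Module (IwasawaAlgebraO S) D.X) (instQ : Module (IwasawaAlgebraO S) DQ.X)
    (hιX : ∀ (f : IwasawaAlgebra p) (x : D.X), (letI := instX; iwasawaToIwasawaO S f • x) = f • x)
    (hιQ : ∀ (f : IwasawaAlgebra p) (x : DQ.X), (letI := instQ; iwasawaToIwasawaO S f • x) = f • x)
    (hCX : ∀ (a : padicCoeffIntegers S) (x : D.X) (s : signedTransportSelmerInftySat κ (Cofree θ (padicCoeffField S)) (padicCoeffIntegers S) V j S₀ ε),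
      D.toDual (letI := instX; (PowerSeries.C a : IwasawaAlgebraO S) • x) s =
        D.toDual x ⟨GreenbergSelmer.scalarH1 κ.kerSubgroup (Cofree θ (padicCoeffField S)) a s,
          scalarH1_mem_signedTransportSelmerInftySat κ (Cofree θ (padicCoeffField S)) (padicCoeffIntegers S) V j S₀ ε a s.2⟩)
    (hCQ : ∀ (a : padicCoeffIntegers S) (x : DQ.X) (c : localCondInftySat κ (Cofree θ (padicCoeffField S)) (padicCoeffIntegers S) V j ε v),
      DQ.toDual (letI := instQ; (PowerSeries.C a : IwasawaAlgebraO S) • x) c = DQ.toDual x (scalarLocalSat κ (Cofree θ (padicCoeffField S)) (padicCoeffIntegers S) V j ε v a c))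
    (hstabK : ∀ m : Cofree θ (padicCoeffField S), IsOpen (MulAction.stabilizer (absoluteGaloisGroup K) m : Set (absoluteGaloisGroup K)))
    (hγ : κ.IsTopGenerator γ) (hγv : κ.IsTopGenerator (resGalOfEmb (closureEmb (K := K) (v.adicCompletion K)) γv)) (hP : P.Finite)
    (hS₀ : S₀.Finite) (hPS₀ : ∀ w ∈ P, w ∉ S₀ → w = v) (hpv : ∀ w : HeightOneSpectrum (𝓞 K), ((p : ℕ) : 𝓞 K) ∈ w.asIdeal → w = v)
    (hMP : ∀ w : HeightOneSpectrum (𝓞 K), w ∉ P → ∀ 𝔓 ∈ w.primesAbove, ∀ τ ∈ 𝔓.inertia (absoluteGaloisGroup K), ∀ m : Cofree θ (padicCoeffField S), τ • m = m)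
    (hsolL : ∀ q : localCondInftySat κ (Cofree θ (padicCoeffField S)) (padicCoeffIntegers S) V j ε v →+ AddCircle (1 : ℚ),
      (∀ s : signedTransportSelmerInftySat κ (Cofree θ (padicCoeffField S)) (padicCoeffIntegers S) V j S₀ ε,
        q (locSat κ (Cofree θ (padicCoeffField S)) (padicCoeffIntegers S) V j S₀ ε v hres hvp s) = 0) →
      ∀ m : ℕ, ∃ y ∈ strictLevel S κ θ' P S₀ m m,
        ∀ (ℓ : subgroupH1 (localSubgroupOfEmb (κ.layerSubgroup m) (closureEmb (K := K) (v.adicCompletion K))) ↥(torsionPow (Cofree θ (padicCoeffField S)) p m))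
          (hℓ : ℓ ∈ goodLevel S κ v (Cofree θ (padicCoeffField S)) V j ε m m),
          locPairNK S κ θ' P v (Cofree θ (padicCoeffField S)) hstab (cofreeLamCoeffPairing S lam hlam θ' P v θ hres hstab hθ) m m y ℓ = q ⟨_, hℓ⟩) :
    letI := instX; letI := instQ
    ∃ j₀ : strictCarrier I (strictLevel S κ θ' P S₀) (fun n k f _ hy ↦ smul_mem_strictLevel S κ θ' P S₀ γB n k f hy) →ₗ[IwasawaAlgebraO S] DQ.X,
      (∀ b, DQ.toDual (j₀ b) = strictPairing (layerPairingOf S κ θ' P v (Cofree θ (padicCoeffField S)) hstab (cofreeLamCoeffPairing S lam hlam θ' P v θ hres hstab hθ) htor γB γv hγB hNP hv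
        (cofreeLamCoeffPairing_hPred S lam hlam θ' P v θ hres hstab hθ) (cofreeLamCoeffPairing_hPsc S lam hlam θ' P v θ hres hstab hθ)) I (strictLevel S κ θ' P S₀)
        (fun n k f _ hy ↦ smul_mem_strictLevel S κ θ' P S₀ γB n k f hy) hstab b) ∧
      Function.Exact j₀ (gXLinearMapO S D DQ hres hvp instX instQ hιX hιQ hCX hCQ htor hstabK hstab hγ hv hγv) :=
  exists_junction_exact_cofree_lam_seq S lam hlam θ D DQ hres hvp I hstab hθ htor hγB hNP hv instX instQ hιX hιQ hCX hCQ hstabK hγ hγv hP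
    (RSeq_cofree_lam S lam hlam θ hres hstab hθ htor hv hinst hstabK hP hS₀ hPS₀ hpv hMP) hsolL

end Cofree

end Summit.BirchSwinnertonDyer.BirchSwinnertonDyer.Theorems.SmallImageRttD2Seq

end
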